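import Summits.BirchSwinnertonDyer.BirchSwinnertonDyer.Theorems.UniversalToricDescentKernelRationalRoadOddMuPointwise
import HarnessLib

/-!
# Route `UniversalToricDescent` — the RATIONAL road's kernel with the twin's ANALYTIC `μ = 0` in RK-7's T-SHAPE
# (part 1/2: squeeze + pointwise kernel): KERNEL CONFIRMATION that `TwinMuZeroAtThreeT` suffices for kernel_rat⁺ 24256

Width prover `bsd-wall-utd-p1-w2` g7 under LEAD `bsd-wall-utd-p1` g20 (`--supports stmt-BirchSwinnertonDyer-20400`). The pen's booked
re-key RK-7 (`Cruxes/ToricTransportModThree/PEN-MEMO-RK7-v1.md`, planning only, needs director GO) replaces the open support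
`TwinMuZeroAtThree` (20400: analytic `μ = 0` for EVERY non-additive twin at EVERY Heegner `K`) on the `closes` cone by its
T-restriction `TwinMuZeroAtThreeT` (odd `d_K`, kernel buckets GoodOrd ∨ Mult ∧ très-ramifié ∨ GoodSS ∧ `a₃ = 0`), whose good part is
print (p720953 + leaf 20790, glue `…TwinMuZeroT.twinMuZeroAtThreeT_of_bcs422_of_multOdd`) and whose residue is the B item
`TwinMuZeroAtThreeMultOdd`. Memo item 4 asks for the kernels' successors hK′/hKr′ with the antecedent swapped. THIS PAIR OF FILES is
the rational road's successor hKr′, kernel-checked BEFORE the re-key exactly as w2 g6 did for R2 (p711326/p720223): READING — the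
rational-road kernel uses `TwinMuZeroAtThree` ONCE (`…KernelRationalRoadSqueeze` §1, l.115: the norm-one coefficient of the twin's
degree frame), at the kernel's Friedberg–Hoffstein field (`d_K` odd) and at the handed twin (bucket known to the trichotomy) — so the
T-shape costs nothing. Part 1 (here): §1″ `charIdeal_eq_of_sigma_of_ratwall_of_frameMu_degreeConditional` (p708172 §1 with a
frame-local `μ` hypothesis) and §2″ `bsdp_three_of_twinDegreeFrameAt_odd_of_sigma_of_ratwall_oddMu_tMu` (p711326 §2 with the
pointwise `hmu'`). Part 2 (`…KernelRationalRoadOddTMuOfR2`): trichotomy / package / `kernelRat_of_r2Text_of_tText` = 24256's text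
with `TwinMuZeroAtThree ↦ T-text` and `TwinAlgMuZeroAtThree ↦ R2-text`.

THEOREMS ONLY; no definition, no named fact, no `sorry`. HONEST FRAMING: implications between route items and displayed hypotheses;
BSD is proved for no curve by this file; 20400 / 24254 / 27120 / 24207 stay OPEN. References: [GreenbergVatsal2000] Thm. (1.4),
Prop. (2.8); [JetchevSkinnerWan2017] §7.4.1; [FriedbergHoffstein1995] Thm. B.
-/

noncomputable section

open scoped Classical

set_option linter.dupNamespace false
set_option autoImplicit false

namespace Summit.BirchSwinnertonDyer.BirchSwinnertonDyer.Theorems.UniversalToricDescentKernelRationalRoadOddT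

open WeierstrassCurve NumberField IsDedekindDomain Field
  Literature.NumberTheory.EllipticCurves
  Literature.NumberTheory.EllipticCurves.ModularForms
  Literature.NumberTheory.EllipticCurves.Rank1Residual
  Literature.NumberTheory.EllipticCurves.KrizLi2019
  Literature.NumberTheory.EllipticCurves.LiuZhangZhang2018
  Summit.BirchSwinnertonDyer.Rank1Residual
  Summit.BirchSwinnertonDyer.Rank1Residual.Additive
  Summit.BirchSwinnertonDyer.Rank1Residual.X11b
  Summit.BirchSwinnertonDyer.Rank1Residual.X11b.AcSelmer
  Summit.BirchSwinnertonDyer.Rank1Residual.X11b.Halves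
  Summit.BirchSwinnertonDyer.BirchSwinnertonDyer.Theses.UniversalToricDescent
  Summit.BirchSwinnertonDyer.BirchSwinnertonDyer.Theorems
  Summit.BirchSwinnertonDyer.BirchSwinnertonDyer.Theorems.UniversalToricDescentTwinChoice
  Summit.BirchSwinnertonDyer.BirchSwinnertonDyer.Theorems.UniversalToricDescentWaldspurgerFlat
  Summit.BirchSwinnertonDyer.BirchSwinnertonDyer.Theorems.UniversalToricDescentKernelOdd
  Summit.BirchSwinnertonDyer.BirchSwinnertonDyer.Theorems.UniversalToricDescentKernelOfPrint
  Summit.BirchSwinnertonDyer.BirchSwinnertonDyer.Theorems.UniversalToricDescentKernelFlatOfPrint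
  Summit.BirchSwinnertonDyer.BirchSwinnertonDyer.Theorems.UniversalToricDescentActDFlatGlue
  Summit.BirchSwinnertonDyer.BirchSwinnertonDyer.Theorems.UniversalToricDescentNormProfile
  Summit.BirchSwinnertonDyer.BirchSwinnertonDyer.Theorems.UniversalToricDescentDefectTransport
  Summit.BirchSwinnertonDyer.BirchSwinnertonDyer.Theorems.UniversalToricDescentDefectPTSqueeze
  Summit.BirchSwinnertonDyer.BirchSwinnertonDyer.Theorems.UniversalToricDescentKernelDefectPTOfPrint
  Summit.BirchSwinnertonDyer.BirchSwinnertonDyer.Theorems.UniversalToricDescentKernelDefectPTTROfPrint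
  Summit.BirchSwinnertonDyer.BirchSwinnertonDyer.Theorems.UniversalToricDescentKernelDegreeOnlyTwin
  Summit.BirchSwinnertonDyer.BirchSwinnertonDyer.Theorems.UniversalToricDescentKernelDegreeOnlyTwinOfPrint
  Summit.BirchSwinnertonDyer.BirchSwinnertonDyer.Cruxes.ToricTransportModThree
  Summit.BirchSwinnertonDyer.BirchSwinnertonDyer.Theorems.UniversalToricDescentKernelRationalRoad
  Summit.BirchSwinnertonDyer.BirchSwinnertonDyer.Theorems.UniversalToricDescentKernelRationalRoadOdd

/-! ### §1″ The per-instance squeeze of the rational road, frame-local analytic μ -/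

section Squeeze

variable (W : WeierstrassCurve ℚ) [W.IsElliptic] [W.IsGloballyMinimal] (W' : WeierstrassCurve ℚ) [W'.IsElliptic]
  [W'.IsGloballyMinimal] (N N' : ℕ) [NeZero N] [NeZero N'] (K : Type) [Field K] [NumberField K]
  (Dt : ModularParametrizationData W N) (Dt' : ModularParametrizationData W' N')

/-- **The cross-squeeze of the RATIONAL road, DEGREE currency, twin ANALYTIC `μ` asked only AT THE TWIN'S OWN FRAMES** =
`…KernelRationalRoad.charIdeal_eq_of_sigma_of_ratwall_of_twinMu_degreeConditional` (LEAD utd-p1 g19, p708172 §1) VERBATIM except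
for its ONLY use of the by-name binder `TwinMuZeroAtThree` (the norm-one coefficient of the twin's degree frame `L′`), which is
replaced by the frame-local displayed hypothesis `hmuW'` (every frame of `f_{W′}` at `(ι′, 𝔭, κ, γ)` has a norm-one coefficient) —
the shape the T-restriction `TwinMuZeroAtThreeT` of RK-7 supplies once `d_K` is odd and the bucket of `W′` is known. At the
`E`-frame `L`, `Ch_Λ(X_E)·R₀⟦T⟧ = (L)`: wall-free ♭T≤ from A and the twin's algebraic `μ = 0` ⇒ `n′ + m ≤ n + m′`; rational wall +
`μ(g) = 0` ⇒ `g ∣ L` ⇒ `n ≤ m`; degree clause ⇒ `m′ ≤ n′`. CONDITIONAL on every displayed hypothesis; BSD is proved for no curve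
by this. [cite: GreenbergVatsal2000, Thm. (1.4), Prop. (2.8)] [cite: JetchevSkinnerWan2017, §7.4.1] -/
theorem charIdeal_eq_of_sigma_of_ratwall_of_frameMu_degreeConditional (hA : SigmaCongruenceAtThree)
    (hrat : RationalSplitIMCInclusionAtThree)
    (hO6 : Additive.ClassO6 W 3) (hsurj : W.HasSurjectiveModNGaloisRep 3) (hr : W.analyticRank = 1)
    (hN : W.conductorNorm ℤ = N) (hcong : O6.ModPCongruent W' W 3) (hss : ¬ Addv W' 3) (hN' : W'.conductorNorm ℤ = N')
    (hK : IsImaginaryQuadratic K) (hHN : SatisfiesHeegnerHypothesis N K) (hHN' : SatisfiesHeegnerHypothesis N' K)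
    (hfinE : ∀ (v : HeightOneSpectrum (𝓞 K)), ((3 : ℕ) : 𝓞 K) ∈ v.asIdeal → Finite (selmerAcBase (W.baseChange K) 3 v ∅))
    (κ : ZpExtension K 3) (hκ : κ.IsAnticyclotomic) (γ : absoluteGaloisGroup K) [Fact (κ.IsTopGenerator γ)]
    (𝔭 : HeightOneSpectrum (𝓞 K)) (h𝔭 : ((3 : ℕ) : 𝓞 K) ∈ 𝔭.asIdeal) (he : 𝔭.asIdeal.ramificationIdx (𝓞 ℚ) = 1)
    (hf : 𝔭.asIdeal.inertiaDeg (𝓞 ℚ) = 1) (𝔭' : HeightOneSpectrum (𝓞 K)) (h𝔭' : ((3 : ℕ) : 𝓞 K) ∈ 𝔭'.asIdeal)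
    (hne : 𝔭' ≠ 𝔭) (ι' : PadicAlgCl 3 ≃+* ℂ) (hind : SchneiderFree.BranchInducesPrime 3 ι' 𝔭)
    (hmuW' : ∀ (ΩK' : ℂ) (Ωp' : ℂ_[3]) (L' : UnrSeries 3), ΩK' ≠ 0 → Ωp' ≠ 0 → IsBDPLFunction ι' 𝔭 κ γ Dt'.f ΩK' Ωp' L' →
      ∃ i : ℕ, ‖((PowerSeries.coeff i L' : unrIntegers 3) : ℂ_[3])‖ = 1)
    (hTμ' : Module.IsTorsion (IwasawaAlgebra 3) (XAc (W'.baseChange K) 3 κ 𝔭' ∅ γ) ∧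
          ∃ g' : UnrSeries 3, (XAc.charIdeal (W'.baseChange K) 3 κ 𝔭' ∅ γ).map (PowerSeries.map (toUnr 3)) =
            Ideal.span {g'} ∧ ∃ i : ℕ, ‖((PowerSeries.coeff i g' : unrIntegers 3) : ℂ_[3])‖ = 1)
    (hdeg : ∃ (ΩK' : ℂ) (Ωp' : ℂ_[3]) (L' : UnrSeries 3), ΩK' ≠ 0 ∧ Ωp' ≠ 0 ∧ IsBDPLFunction ι' 𝔭 κ γ Dt'.f ΩK' Ωp' L' ∧
      (Module.IsTorsion (IwasawaAlgebra 3) (XAc (W'.baseChange K) 3 κ 𝔭' ∅ γ) →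
        ∀ (g : UnrSeries 3) (n m : ℕ),
          (XAc.charIdeal (W'.baseChange K) 3 κ 𝔭' ∅ γ).map (PowerSeries.map (toUnr 3)) = Ideal.span {g} →
          (∀ i < n, ‖((PowerSeries.coeff i g : unrIntegers 3) : ℂ_[3])‖ < 1) ∧
              ‖((PowerSeries.coeff n g : unrIntegers 3) : ℂ_[3])‖ = 1 →
          (∀ i < m, ‖((PowerSeries.coeff i L' : unrIntegers 3) : ℂ_[3])‖ < 1) ∧
              ‖((PowerSeries.coeff m L' : unrIntegers 3) : ℂ_[3])‖ = 1 →
          m ≤ n))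
    {ΩK : ℂ} {Ωp : ℂ_[3]} {L : UnrSeries 3} (hΩK : ΩK ≠ 0) (hΩp : Ωp ≠ 0)
    (hBDP : IsBDPLFunction ι' 𝔭 κ γ Dt.f ΩK Ωp L) :
    (XAc.charIdeal (W.baseChange K) 3 κ 𝔭' ∅ γ).map (PowerSeries.map (toUnr 3)) = Ideal.span {L} := by
  -- VERBATIM p708172 §1; the ONE change: `hi'` comes from the frame-local `hmuW'` instead of `TwinMuZeroAtThree`
  obtain ⟨ΩK', Ωp', L', hΩK', hΩp', hBDP', hdegT⟩ := hdeg
  have hi' : ∃ i : ℕ, ‖((PowerSeries.coeff i L' : unrIntegers 3) : ℂ_[3])‖ = 1 := hmuW' ΩK' Ωp' L' hΩK' hΩp' hBDP'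
  obtain ⟨k, hk⟩ := hrat W N K Dt hO6 hsurj hr hN hK hHN κ hκ γ 𝔭 h𝔭 he hf 𝔭' h𝔭' hne ι' hind ΩK Ωp L hΩK hΩp hBDP
  obtain ⟨g, g', n, m, n', m', hIE, hI', hg, hL, hg', hL', hsum⟩ :=
    UniversalToricDescentDefectTransportModThreePTWallFree.defectTransportPT_wallFree_of_sigmaCongruence hA W W' N N' K Dt Dt'
      hO6 hsurj hr hN hcong hss hN' hK hHN hHN' hfinE κ hκ γ 𝔭 𝔭' h𝔭 he hf h𝔭' hne ι' hind hTμ'.1 hTμ'.2 ΩK Ωp L hΩK hΩp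
      hBDP ΩK' Ωp' L' hΩK' hΩp' hBDP' hi'
  have hgdvd : g ∣ ((3 : ℕ) : UnrSeries 3) ^ k * L := Ideal.mem_span_singleton.mp (hIE ▸ hk)
  rw [← map_natCast (PowerSeries.C (R := unrIntegers 3))] at hgdvd
  have hgL : g ∣ L :=
    RatwallThinComb.dvd_of_dvd_prime_pow_mul RatwallThinComb.prime_C_three
      (RatwallThinComb.not_C_three_dvd_of_norm_coeff_eq_one hg.2) k hgdvd
  have h₁ : n ≤ m := firstUnitCoeff_le_of_dvd hgL hg.1 hL.2
  have h₂ : m' ≤ n' := hdegT hTμ'.1 g' n' m' hI' hg' hL'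
  have hnm : n = m := by omega
  subst hnm
  exact hIE.trans (span_eq_span_of_dvd_of_normProfile hgL hg.1 hL.2)

end Squeeze

/-! ### §2″ The pointwise kernel of the rational road, analytic μ pointwise (T-shape) -/

/-- **Pointwise kernel of the RATIONAL road, twin algebraic `μ = 0` at odd `d_K` AND twin analytic `μ = 0` POINTWISE** =
`…KernelRationalRoadOdd.bsdp_three_of_twinDegreeFrameAt_odd_of_sigma_of_ratwall_oddMu` (width utd-p1-w2 g6, p711326) VERBATIM except
that the by-name binder `TwinMuZeroAtThree` (stmt-…-20400) is replaced by the displayed POINTWISE hypothesis `hmu'`: for the handed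
pair `(W, W′)`, at every level/field/branch datum with `d_K` ODD, every frame of `f_{W′}` has a norm-one coefficient — the text of
RK-7's `TwinMuZeroAtThreeT` with the curve binders fixed and the bucket guard removed (the trichotomy above this kernel knows the
bucket). Costs nothing: the kernel instantiates `hmu'` only at its Friedberg–Hoffstein field (`d_K` odd) with `Dt` in hand, through §1″.
CONDITIONAL on every displayed hypothesis; BSD is proved for no curve by this.
[cite: JetchevSkinnerWan2017, §7.4.1] [cite: FriedbergHoffstein1995, Thm. B] [cite: GreenbergVatsal2000, Thm. (1.4), Prop. (2.8)] -/
theorem bsdp_three_of_twinDegreeFrameAt_odd_of_sigma_of_ratwall_oddMu_tMu (hF : ToricPublishedInputs)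
    (hA : SigmaCongruenceAtThree) (hrat : RationalSplitIMCInclusionAtThree)
    (hPT : PoitouTateSelmerStructureDualityFact)
    (hV : ∀ (W : WeierstrassCurve ℚ) [W.IsElliptic] [W.IsGloballyMinimal] (N : ℕ) [NeZero N] (K : Type)
      [Field K] [NumberField K] (Dt : ModularParametrizationData W N) (H : HeegnerDatum N (NumberField.discr K))
      (ι : K →+* ℂ) (P : (W.baseChange K).toAffine.Point),
      Additive.ClassO6 W 3 → W.HasSurjectiveModNGaloisRep 3 → W.analyticRank = 1 → W.conductorNorm ℤ = N →
      IsImaginaryQuadratic K → SatisfiesHeegnerHypothesis N K → Odd (NumberField.discr K) →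
      (W.quadraticTwist (NumberField.discr K : ℚ)).entireLFunction 1 ≠ 0 →
      (WeierstrassCurve.Affine.Point.map ι.toRatAlgHom) P = heegnerPointComplex Dt H → ¬ IsOfFinAddOrder P →
      ∀ (κ : ZpExtension K 3), κ.IsAnticyclotomic → ∀ (γ : absoluteGaloisGroup K) [Fact (κ.IsTopGenerator γ)]
        (𝔭 : HeightOneSpectrum (𝓞 K)) (h𝔭 : ((3 : ℕ) : 𝓞 K) ∈ 𝔭.asIdeal)
        (he : 𝔭.asIdeal.ramificationIdx (𝓞 ℚ) = 1) (hf : 𝔭.asIdeal.inertiaDeg (𝓞 ℚ) = 1),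
        ∃ ι' : PadicAlgCl 3 ≃+* ℂ, SchneiderFree.BranchInducesPrime 3 ι' 𝔭 ∧
          ∃ (ΩK : ℂ) (Ωp : ℂ_[3]) (L : UnrSeries 3), ΩK ≠ 0 ∧ Ωp ≠ 0 ∧ IsBDPLFunction ι' 𝔭 κ γ Dt.f ΩK Ωp L ∧
            ∃ u : (unrIntegers 3)ˣ, L.HasValueAt 0 ((((u : unrIntegers 3) : unrIntegers 3) : ℂ_[3]) *
              (algebraMap ℚ_[3] ℂ_[3] (logOmega W 3 (embAt K 3 𝔭 h𝔭 he hf) P / (Dt.c : ℚ_[3]))) ^ 2))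
    (hC : WildSplitControlAtThree) (hZ : WildRankZeroTwistAtThree)
    (W : WeierstrassCurve ℚ) [W.IsElliptic] [W.IsGloballyMinimal]
    (hO6 : Additive.ClassO6 W 3) (hr : W.analyticRank = 1) (hsurj : W.HasSurjectiveModNGaloisRep 3)
    (W' : WeierstrassCurve ℚ) [W'.IsElliptic] [W'.IsGloballyMinimal]
    (hcong : O6.ModPCongruent W' W 3) (hW'ss : ¬ Addv W' 3)
    (hmu' : ∀ (N N' : ℕ) [NeZero N] [NeZero N'] (K : Type) [Field K] [NumberField K]
      (Dt : ModularParametrizationData W N) (Dt' : ModularParametrizationData W' N'),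
      W.conductorNorm ℤ = N → W'.conductorNorm ℤ = N' → IsImaginaryQuadratic K → SatisfiesHeegnerHypothesis N K →
      SatisfiesHeegnerHypothesis N' K → Odd (NumberField.discr K) → ∀ (κ : ZpExtension K 3), κ.IsAnticyclotomic →
      ∀ (γ : absoluteGaloisGroup K) [Fact (κ.IsTopGenerator γ)] (𝔭 : HeightOneSpectrum (𝓞 K)),
        ((3 : ℕ) : 𝓞 K) ∈ 𝔭.asIdeal → 𝔭.asIdeal.ramificationIdx (𝓞 ℚ) = 1 →
        𝔭.asIdeal.inertiaDeg (𝓞 ℚ) = 1 →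
      ∀ (𝔭' : HeightOneSpectrum (𝓞 K)), ((3 : ℕ) : 𝓞 K) ∈ 𝔭'.asIdeal → 𝔭' ≠ 𝔭 →
      ∀ (ι' : PadicAlgCl 3 ≃+* ℂ), SchneiderFree.BranchInducesPrime 3 ι' 𝔭 →
      ∀ (ΩK : ℂ) (Ωp : ℂ_[3]) (L' : UnrSeries 3), ΩK ≠ 0 → Ωp ≠ 0 → IsBDPLFunction ι' 𝔭 κ γ Dt'.f ΩK Ωp L' →
        ∃ i : ℕ, ‖((PowerSeries.coeff i L' : unrIntegers 3) : ℂ_[3])‖ = 1)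
    (hI' : ∀ (N' : ℕ) [NeZero N'] (K : Type) [Field K] [NumberField K]
      (Dt' : ModularParametrizationData W' N'), W'.conductorNorm ℤ = N' → IsImaginaryQuadratic K →
      SatisfiesHeegnerHypothesis N' K → Odd (NumberField.discr K) →
      ∀ (κ : ZpExtension K 3), κ.IsAnticyclotomic →
      ∀ (γ : absoluteGaloisGroup K) [Fact (κ.IsTopGenerator γ)] (𝔭 : HeightOneSpectrum (𝓞 K)),
        ((3 : ℕ) : 𝓞 K) ∈ 𝔭.asIdeal → 𝔭.asIdeal.ramificationIdx (𝓞 ℚ) = 1 →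
        𝔭.asIdeal.inertiaDeg (𝓞 ℚ) = 1 →
      ∀ (𝔭' : HeightOneSpectrum (𝓞 K)), ((3 : ℕ) : 𝓞 K) ∈ 𝔭'.asIdeal → 𝔭' ≠ 𝔭 →
      ∀ (ι' : PadicAlgCl 3 ≃+* ℂ), SchneiderFree.BranchInducesPrime 3 ι' 𝔭 →
        ∃ (ΩK : ℂ) (Ωp : ℂ_[3]) (L' : UnrSeries 3), ΩK ≠ 0 ∧ Ωp ≠ 0 ∧
          IsBDPLFunction ι' 𝔭 κ γ Dt'.f ΩK Ωp L' ∧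
          (Module.IsTorsion (IwasawaAlgebra 3) (XAc (W'.baseChange K) 3 κ 𝔭' ∅ γ) →
            ∀ (g : UnrSeries 3) (n m : ℕ),
              (XAc.charIdeal (W'.baseChange K) 3 κ 𝔭' ∅ γ).map (PowerSeries.map (toUnr 3)) = Ideal.span {g} →
              (∀ i < n, ‖((PowerSeries.coeff i g : unrIntegers 3) : ℂ_[3])‖ < 1) ∧
                  ‖((PowerSeries.coeff n g : unrIntegers 3) : ℂ_[3])‖ = 1 →
              (∀ i < m, ‖((PowerSeries.coeff i L' : unrIntegers 3) : ℂ_[3])‖ < 1) ∧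
                  ‖((PowerSeries.coeff m L' : unrIntegers 3) : ℂ_[3])‖ = 1 →
              m ≤ n))
    (hTμ' : ∀ (N N' : ℕ) [NeZero N] [NeZero N'] (K : Type) [Field K] [NumberField K]
      (Dt : ModularParametrizationData W N) (Dt' : ModularParametrizationData W' N'),
      W.conductorNorm ℤ = N → W'.conductorNorm ℤ = N' → IsImaginaryQuadratic K → SatisfiesHeegnerHypothesis N K →
      SatisfiesHeegnerHypothesis N' K → Odd (NumberField.discr K) → ∀ (κ : ZpExtension K 3), κ.IsAnticyclotomic →
      ∀ (γ : absoluteGaloisGroup K) [Fact (κ.IsTopGenerator γ)] (𝔭 : HeightOneSpectrum (𝓞 K)),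
        ((3 : ℕ) : 𝓞 K) ∈ 𝔭.asIdeal → 𝔭.asIdeal.ramificationIdx (𝓞 ℚ) = 1 →
        𝔭.asIdeal.inertiaDeg (𝓞 ℚ) = 1 →
      ∀ (𝔭' : HeightOneSpectrum (𝓞 K)), ((3 : ℕ) : 𝓞 K) ∈ 𝔭'.asIdeal → 𝔭' ≠ 𝔭 →
        Module.IsTorsion (IwasawaAlgebra 3) (XAc (W'.baseChange K) 3 κ 𝔭' ∅ γ) ∧
          ∃ g' : UnrSeries 3, (XAc.charIdeal (W'.baseChange K) 3 κ 𝔭' ∅ γ).map (PowerSeries.map (toUnr 3)) =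
            Ideal.span {g'} ∧ ∃ i : ℕ, ‖((PowerSeries.coeff i g' : unrIntegers 3) : ℂ_[3])‖ = 1) :
    BSDp W 3 := by
  -- VERBATIM p711326 §2 (itself p708172 §2); the ONE change: `heq` comes from §1″ fed by `hmu'` at the FH field (`hodd` in hand)
  obtain ⟨hGZ, hKo, hGZK, hmod, hmodP, -, hGZ73, hFH, hpar, hHP⟩ := hF
  haveI hN0 : NeZero (W.conductorNorm ℤ) := ⟨W.conductorNorm_pos_holds.ne'⟩
  haveI hN0' : NeZero (W'.conductorNorm ℤ) := ⟨W'.conductorNorm_pos_holds.ne'⟩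
  have hw : W.rootNumber = -1 := by
    rcases W.rootNumber_eq_one_or with h | h
    · exfalso
      have heven : Even W.analyticRank := (hpar W).mpr h
      rw [hr] at heven
      exact Nat.not_even_one heven
    · exact h
  obtain ⟨K, _, _, hK, -, hHN, hH2N', hLt⟩ :=
    hFH W hw (2 * W'.conductorNorm ℤ) (mul_ne_zero two_ne_zero hN0'.out) 0
  have hHN' : SatisfiesHeegnerHypothesis (W'.conductorNorm ℤ) K :=
    SatisfiesHeegnerHypothesis.of_dvd (dvd_mul_left _ 2) hH2N'
  have hodd : Odd (NumberField.discr K) := by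
    have h8 := Literature.SatisfiesHeegnerHypothesis.discr_emod_eight hK.1 hH2N' (dvd_mul_right 2 _)
    rw [Int.odd_iff]; omega
  have h3N : 3 ∣ W.conductorNorm ℤ :=
    (W.dvd_conductorNorm_iff_not_hasGoodReductionAtPrime 3).mpr (not_good_of_addv W 3 hO6.2.1)
  have hsplit : SplitsIn K 3 := hHN 3 Nat.prime_three h3N
  obtain ⟨P, Dt, H, ι, hP⟩ := hHP W K hK hHN
  have hL0 : W.entireLFunction 1 = 0 := entireLFunction_one_eq_zero_of_analyticRank_eq_one hr
  obtain ⟨-, hderiv⟩ := leadingLCoeff_eq_deriv_of_analyticRank_eq_one hr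
  have hLK : LDerivEK W K ≠ 0 := by
    rw [lDerivEK_eq_deriv_mul W K hmod hL0]; exact mul_ne_zero hderiv hLt
  have hnt : ¬ IsOfFinAddOrder P :=
    (lDerivEK_ne_zero_iff_not_isOfFinAddOrder W (W.conductorNorm ℤ) K (hGZ _ W K) hK hHN
      ⟨Dt, H, ι, hP⟩).mp hLK
  obtain ⟨hrk, hfin⟩ := hKo (W.conductorNorm ℤ) W K hK hHN ⟨Dt, H, ι, hP⟩ hnt
  obtain ⟨Dt'⟩ := hmodP W'
  obtain ⟨κ, γ, -, hκ, hγ, -⟩ := X11b.exists_anticyclotomic_generator_prime (p := 3) hK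
  haveI : Fact (κ.IsTopGenerator γ) := ⟨hγ⟩
  obtain ⟨𝔭, h𝔭, he, hf⟩ := X11b.exists_degreeOnePrime_of_splitsIn K 3 hK.1 hsplit
  obtain ⟨𝔭', hne, h𝔭', he', hf'⟩ := X11b.Three.exists_ne_degreeOne_prime hK.1 h𝔭 he hf
  obtain ⟨ι', hind, ΩK, Ωp, L, hΩK, hΩp, hBDP, u, hval⟩ :=
    hV W (W.conductorNorm ℤ) K Dt H ι P hO6 hsurj hr rfl hK hHN hodd hLt hP hnt κ hκ γ 𝔭 h𝔭 he hf
  -- «deg»: the twin's frame with its TORSION-CONDITIONAL DEGREE clause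
  have hdeg' := hI' (W'.conductorNorm ℤ) K Dt' rfl hK hHN' hodd κ hκ γ 𝔭 h𝔭 he hf 𝔭' h𝔭' hne ι' hind
  have hctl : SchneiderFree.AdditiveControlOnTreeAt 3 κ 𝔭' γ (embAt K 3 𝔭' h𝔭' he' hf') P :=
    hC W (W.conductorNorm ℤ) K Dt H ι P hO6 hsurj hr rfl hK hHN hLt hP hnt (hKo _ W K) κ hκ γ 𝔭'
      h𝔭' he' hf'
  obtain ⟨n, hn, hneq⟩ := hctl
  -- «act E»: the wild curve's base finiteness at every `v ∋ 3`, from rank-one data over `K`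
  have hfinE : ∀ (v : HeightOneSpectrum (𝓞 K)), ((3 : ℕ) : 𝓞 K) ∈ v.asIdeal →
      Finite (selmerAcBase (W.baseChange K) 3 v ∅) := by
    intro v hv
    haveI : Finite (W.baseChange K).sha := hfin
    have hSha3 : Finite (AddCommGroup.primaryComponent (W.baseChange K).sha 3) := inferInstance
    obtain ⟨he'', hf''⟩ := X11b.degreeOne_of_splitsIn hK.1 hsplit hv
    obtain ⟨hfinv, -⟩ :=
      SchneiderFreeAdditiveX3.natCard_selmerAcBase_mul_eq_of_rankOne_anyTorsion_shaPrimary W 3 K (hPT K)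
        (localEulerPoincareCharacteristicFact_proof K) hK hsplit hrk hSha3 P hnt v hv he'' hf''
    exact hfinv
  -- «rat»: A → rational wall → twin algebraic μ → μ squeeze in the DEGREE currency (§1): IMC EQUALITY for `E` at `L`
  have hTμi := hTμ' (W.conductorNorm ℤ) (W'.conductorNorm ℤ) K Dt Dt' rfl rfl hK hHN hHN' hodd κ hκ γ 𝔭 h𝔭 he hf 𝔭'
    h𝔭' hne
  have heq : (XAc.charIdeal (W.baseChange K) 3 κ 𝔭' ∅ γ).map (PowerSeries.map (toUnr 3)) =
      Ideal.span {L} :=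
    charIdeal_eq_of_sigma_of_ratwall_of_frameMu_degreeConditional W W' (W.conductorNorm ℤ) (W'.conductorNorm ℤ) K Dt Dt'
      hA hrat hO6 hsurj hr rfl hcong hW'ss rfl hK hHN hHN' hfinE κ hκ γ 𝔭 h𝔭 he hf 𝔭' h𝔭' hne ι' hind
      (hmu' (W.conductorNorm ℤ) (W'.conductorNorm ℤ) K Dt Dt' rfl rfl hK hHN hHN' hodd κ hκ γ 𝔭 h𝔭 he hf 𝔭' h𝔭' hne ι' hind)
      hTμi hdeg' hΩK hΩp hBDP
  have hval' : L.HasValueAt 0 ((((u : unrIntegers 3) : unrIntegers 3) : ℂ_[3]) *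
      (algebraMap ℚ_[3] ℂ_[3]
        (logOmega W 3 (embAt K 3 𝔭' h𝔭' he' hf') P / (Dt.c : ℚ_[3]))) ^ 2) :=
    (SchneiderFreeAdditiveX3.hasValueAt_sq_logOmega_embAt_iff_of_rank_one W 3 hK.1 hrk h𝔭 he hf
      h𝔭' he' hf' P _ _ L).mpr hval
  have hc0 : Dt.c ≠ 0 := Dt.maninConstant_ne_zero_holds
  have hlog : logOmega W 3 (embAt K 3 𝔭' h𝔭' he' hf') P ≠ 0 := X11b.R1.logOmega_ne_zero W 3 _ hnt
  have hlow : SchneiderFree.AdditiveIMCLowerBDPOnTreeLeAt 3 κ 𝔭' γ (embAt K 3 𝔭' h𝔭' he' hf')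
      (padicValNat 3 Dt.c.natAbs) P := by
    obtain ⟨htors, f, hfI, hf0, hfn⟩ := hn
    have hmem : PowerSeries.map (toUnr 3) f ∈ Ideal.span {L} := by
      have h3 := heq.le
      rw [hfI, CongruenceLimit.map_span_singleton_powerSeries] at h3
      exact (Ideal.span_singleton_le_iff_mem _).mp h3
    obtain ⟨-, hle⟩ := Supersingular.two_mul_valuation_le_of_mem_span 3 hf0 hmem u hval'
    have hc0' : (Dt.c : ℚ_[3]) ≠ 0 := by exact_mod_cast hc0
    rw [div_eq_mul_inv, Padic.valuation_mul hlog (inv_ne_zero hc0'), Padic.valuation_inv,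
      Padic.valuation_intCast, valuation_logOmega hlog, hfn] at hle
    refine ⟨n, ⟨htors, f, hfI, hf0, hfn⟩, ?_⟩
    simp only [padicValInt] at hle
    linarith
  have hup : SchneiderFree.Upper.AdditiveIMCUpperBDPOnTreeLeAt 3 κ 𝔭' γ (embAt K 3 𝔭' h𝔭' he' hf')
      (padicValNat 3 Dt.c.natAbs) P :=
    SchneiderFree.Upper.additiveIMCUpperBDPOnTreeLeAt_of_value_of_dvd' hn heq.ge u hc0 hlog hval'
  have hlo : SchneiderFree.IndexLowerBoundLeAt W 3 K P (padicValNat 3 Dt.c.natAbs) :=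
    SchneiderFreeAdditiveX3.indexLowerBoundLeAt_of_imcLowerLe_of_control rfl hK hHN hfin hlow
      ⟨n, hn, hneq⟩
  have hupI : SchneiderFree.Upper.IndexUpperBoundLeAt W 3 K P (padicValNat 3 Dt.c.natAbs) :=
    SchneiderFree.Upper.indexUpperBoundLeAt_of_imcUpperLe_of_control rfl hK hHN hfin hup ⟨n, hn, hneq⟩
  have hD0 : (NumberField.discr K : ℚ) ≠ 0 := by exact_mod_cast NumberField.discr_ne_zero K
  haveI : (W.quadraticTwist (NumberField.discr K : ℚ)).IsElliptic := W.isElliptic_quadraticTwist hD0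
  obtain ⟨Cd, hCd⟩ := hasGlobalMinimalModel_rat_holds (W.quadraticTwist (NumberField.discr K : ℚ))
  haveI : (Cd • W.quadraticTwist (NumberField.discr K : ℚ)).IsGloballyMinimal := hCd
  exact SchneiderFree.Exact.bsdp_three_of_exactIndexManin_of_wAllExclAddWildRankZero hGZ hKo hGZK hmod
    hGZ73 hZ W hO6 hsurj hr (W.conductorNorm ℤ) K Dt H ι P
    (Cd • W.quadraticTwist (NumberField.discr K : ℚ)) rfl hK hodd hHN hLt hP ⟨Cd, rfl⟩ hlo hupI

end Summit.BirchSwinnertonDyer.BirchSwinnertonDyer.Theorems.UniversalToricDescentKernelRationalRoadOddT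

end
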